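import Summits.CriticalPhenomena.PercolationContinuityZ3.Theorems.PercNearOneGluingNoHeavyLowerTailFourCopyHubSoundC
import Mathlib.Algebra.BigOperators.Ring.Finset
import Mathlib.Data.Fin.Tuple.Sort
import HarnessLib

/-!
# `NoHeavyLowerTail` (stmt-CriticalPhenomena-4575) — FOUR-copy switching certificates, V: expectations — the certificate
# principle for hub certificates, the canonical input potential, and the cubic `E₃` conclusion

Support file (prover prim-ineq-prove-3 gen 8; `--supports stmt-CriticalPhenomena-4575`).  No named facts, no sorries.

A hub certificate `c` (parts III–IV) comes with a TARGET (three sets of four-terminal types `EA, EB, EC`, read on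
copies `1, 2, 3`), a positive scale `Dsc`, and a list of TRANSFERS (pairs of type cells that are permutations of each
other, with an integer amount): the input potential is the canonical one,
`λ₀(o) = −(Pc(o) + Dsc·Tc(o) − z(o))`, where `Pc` is the sum of the program potentials read at the INPUT cell `o`,
`Tc` is the ordered cell function of the cubic `E₃(EA,EB,EC)` and `z` is the function of the transfers (zero
symmetrisation by construction).  If the kernel check `piCheck` passes for all fifteen source types with the bound
`B = Pc + Dsc·Tc − z` (and covers all hub states), then for every finite graph, placement of the four terminals and
coordinate probabilities in `[0,1]`:
`0 ≤ 2·P(A∩B∩C) + P(A)P(B)P(C) − P(A)P(B∩C) − P(B)P(A∩C) − P(C)P(A∩B)` (`e3_nonneg_of_hubCert`), where `A = {type ∈ EA}`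
etc.  Proof: `E[S] = E[Pc(code)]` (measure preservation, part I), `S ≤ B(code)` pointwise (part IV), `E[z(code)] = 0`
(transfers between permuted cells have equal product weights), `E[Tc(code)] = E₃` (independence of the copies).
-/

noncomputable section

namespace Summit.CriticalPhenomena.PercolationContinuityZ3.Theorems

namespace FourCopyHub

open Finset Literature.Probability.Percolation Literature.Probability.Percolation.DecisionTree
open Literature.Probability.Percolation.Gladkov ThreePointLB GroupThreePointLB FourPointAtoms SwitchRelax SwitchingK
open scoped Classical

/-! ### Targets and the ordered target cell function -/

/-- A cubic target: three sets of types (the events of copies `1, 2, 3`). [this work] -/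
structure E3Target where
  /-- first event -/
  EA : Ty → Bool
  /-- second event -/
  EB : Ty → Bool
  /-- third event -/
  EC : Ty → Bool

/-- `0/1` of a Boolean. [folklore] -/
def ib (b : Bool) : ℤ := if b then 1 else 0
/-- `ib true = 1`. [folklore] -/
@[simp] theorem ib_true : ib true = 1 := rfl
/-- `ib` is multiplicative on `&&`. [folklore] -/
theorem ib_and (a b : Bool) : ib (a && b) = ib a * ib b := by cases a <;> cases b <;> rfl

/-- The ordered cell function of `E₃`: on the cell `(t₀,t₁,t₂,t₃)` of input types,
`2·[t₁ ∈ A∩B∩C] + [t₁∈A][t₂∈B][t₃∈C] − [t₁∈A][t₂∈B∩C] − [t₁∈B][t₂∈A∩C] − [t₁∈C][t₂∈A∩B]`; its expectation under four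
independent copies is `E₃`. [this work] -/
def Tc (E : E3Target) (t1 t2 t3 : Ty) : ℤ :=
  2 * ib (E.EA t1 && E.EB t1 && E.EC t1) + ib (E.EA t1) * ib (E.EB t2) * ib (E.EC t3)
  - ib (E.EA t1) * ib (E.EB t2 && E.EC t2) - ib (E.EB t1) * ib (E.EA t2 && E.EC t2) - ib (E.EC t1) * ib (E.EA t2 && E.EB t2)

/-- The potentials of a certificate read at an input cell. [this work] -/
def Pc (c : Cert) (o : St4) : ℤ := (c.one.map fun q => q.ev c o).sum + (c.two.map fun q => q.ev c o).sum

/-! ### Permutations of the four copies, sparse cell tables and their symmetrisation -/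

/-- The 24 permutations of `Fin 4`. [folklore] -/
def permL : List (Fin 4 → Fin 4) :=
  [![0,1,2,3], ![0,1,3,2], ![0,2,1,3], ![0,2,3,1], ![0,3,1,2], ![0,3,2,1],
   ![1,0,2,3], ![1,0,3,2], ![1,2,0,3], ![1,2,3,0], ![1,3,0,2], ![1,3,2,0],
   ![2,0,1,3], ![2,0,3,1], ![2,1,0,3], ![2,1,3,0], ![2,3,0,1], ![2,3,1,0],
   ![3,0,1,2], ![3,0,2,1], ![3,1,0,2], ![3,1,2,0], ![3,2,0,1], ![3,2,1,0]]

/-- Every listed map is a bijection. [folklore] -/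
theorem permL_bijective : ∀ π ∈ permL, Function.Bijective π := by decide +kernel

/-- `permL` has 24 entries. [folklore] -/
theorem length_permL : permL.length = 24 := rfl

/-- Every injection of `Fin 4` is listed. [folklore] -/
theorem mem_permL_of_injective (π : Fin 4 → Fin 4) (h : Function.Injective π) : π ∈ permL := by
  have key : ∀ a b c d : Fin 4, Function.Injective (![a, b, c, d] : Fin 4 → Fin 4) →
      (![a, b, c, d] : Fin 4 → Fin 4) ∈ permL := by
    decide +kernel
  have e : π = ![π 0, π 1, π 2, π 3] := by funext i; fin_cases i <;> rfl
  rw [e] at h ⊢; exact key _ _ _ _ h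

/-- `permL` is closed under left composition, as a permutation of the list. [folklore] -/
theorem permL_comp_perm : ∀ ρ ∈ permL, (permL.map fun π => ρ ∘ π).Perm permL := by decide +kernel

/-- Equality of cells (Boolean). [folklore] -/
def ceq (o o' : St4) : Bool := decide (o 0 = o' 0 ∧ o 1 = o' 1 ∧ o 2 = o' 2 ∧ o 3 = o' 3)

/-- `ceq` decides equality of cells. [folklore] -/
theorem ceq_eq_true_iff (o o' : St4) : ceq o o' = true ↔ o = o' := by
  rw [ceq, decide_eq_true_iff]
  constructor
  · rintro ⟨h0, h1, h2, h3⟩; funext i; fin_cases i <;> assumption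
  · rintro rfl; exact ⟨rfl, rfl, rfl, rfl⟩

/-- A SPARSE table on cells: bucket `[t₀][t₁]` lists entries `(t₂, t₃, value)`. [this work] -/
abbrev ZS := List (List (List (ℕ × ℕ × ℤ)))

/-- Sum of the entries of a bucket at `(i, j)`. [this work] -/
def zfind (L : List (ℕ × ℕ × ℤ)) (i j : ℕ) : ℤ := ((L.filter fun e => e.1 = i ∧ e.2.1 = j).map fun e => e.2.2).sum

/-- The cell function of a sparse table. [this work] -/
def zlkS (Z : ZS) (o : St4) : ℤ := zfind (lk (lk Z (o 0).val []) (o 1).val []) (o 2).val (o 3).val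

/-- Sorted cells. [this work] -/
def srt (o : St4) : Bool := decide (o 0 ≤ o 1) && decide (o 1 ≤ o 2) && decide (o 2 ≤ o 3)

/-- Symmetrisation of a cell function over the 24 permutations of the copies. [this work] -/
def symS (f : St4 → ℤ) (o : St4) : ℤ := (permL.map fun π => f (o ∘ π)).sum

/-- **The symmetrisation check**: the symmetrisation of the table is nonnegative at every SORTED cell. [this work] -/
def zsymOK (Z : ZS) : Bool :=
  allTys.all fun a => (allTys.filter fun b => a ≤ b).all fun b => (allTys.filter fun c' => b ≤ c').all fun c' =>
    (allTys.filter fun d => c' ≤ d).all fun d => decide (0 ≤ symS (zlkS Z) (mk4 a b c' d))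

/-- Symmetrisation is invariant under permuting the cell. [this work] -/
theorem symS_comp (f : St4 → ℤ) (o : St4) {ρ : Fin 4 → Fin 4} (hρ : ρ ∈ permL) : symS f (o ∘ ρ) = symS f o := by
  unfold symS
  have e : (permL.map fun π => f ((o ∘ ρ) ∘ π)) = (permL.map fun π => ρ ∘ π).map fun π => f (o ∘ π) := by
    rw [List.map_map]; rfl
  rw [e]
  exact ((permL_comp_perm ρ hρ).map _).sum_eq

/-- A nonnegative symmetrisation at sorted cells is nonnegative everywhere (sort the cell). [this work] -/
theorem symS_nonneg_of_sorted (f : St4 → ℤ) (h : ∀ s : St4, srt s = true → 0 ≤ symS f s) (o : St4) : 0 ≤ symS f o := by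
  set σ := Tuple.sort o with hσ
  have hs : Monotone (o ∘ ⇑σ) := Tuple.monotone_sort o
  have hsrt : srt (o ∘ ⇑σ) = true := by
    simp only [srt, Bool.and_eq_true, decide_eq_true_iff]
    exact ⟨⟨hs (by decide), hs (by decide)⟩, hs (by decide)⟩
  have ho : o = (o ∘ ⇑σ) ∘ ⇑σ.symm := by
    funext i; simp only [Function.comp, Equiv.apply_symm_apply]
  rw [ho, symS_comp f _ (mem_permL_of_injective _ σ.symm.injective)]
  exact h _ hsrt

/-- What the check certifies. [this work] -/
theorem symS_nonneg_of_zsymOK {Z : ZS} (h : zsymOK Z = true) (o : St4) : 0 ≤ symS (zlkS Z) o := by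
  refine symS_nonneg_of_sorted _ (fun s hs => ?_) o
  simp only [zsymOK, List.all_eq_true, decide_eq_true_iff, List.mem_filter] at h
  simp only [srt, Bool.and_eq_true, decide_eq_true_iff] at hs
  have e : mk4 (s 0) (s 1) (s 2) (s 3) = s := by funext i; fin_cases i <;> rfl
  rw [← e]
  exact h (s 0) (mem_allTys _) (s 1) ⟨mem_allTys _, hs.1.1⟩ (s 2) ⟨mem_allTys _, hs.1.2⟩ (s 3) ⟨mem_allTys _, hs.2⟩

/-! ### The bound function of a hub certificate -/

/-- **The bound** `B(πX, t₁, t₂, t₃) = Pc + Dsc·Tc − z` (canonical input potential `λ₀ = −B`). [this work] -/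
def Bfun (c : Cert) (E : E3Target) (Dsc : ℕ) (Z : ZS) (πX t1 t2 t3 : Ty) : ℤ :=
  Pc c (mk4 πX t1 t2 t3) + Dsc * Tc E t1 t2 t3 - zlkS Z (mk4 πX t1 t2 t3)

/-! ### Expectations over four independent copies -/

section Expect

variable {V : Type*} [Fintype V] [DecidableEq V] (τ : Fin 4 → V) (D : Finset (Sym2 V)) (p : Sym2 V → ℝ)

/-- The event "the type of the configuration satisfies `P`". [this work] -/
def evT (P : Ty → Bool) : Set (Finset (Sym2 V)) := {K | P (ftype τ K) = true}

omit [Fintype V] in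
/-- `Σ_x wt(x)·Π_j g_j(x_j) = Π_j Σ_S wt(S) g_j(S)` (independence of the four copies). [folklore] -/
theorem sum_wtKW_prod (g : Fin 4 → Finset (Sym2 V) → ℝ) :
    ∑ x ∈ tuplesK D 4, wtKW D p x * ∏ j, g j (x j) = ∏ j, ∑ S ∈ D.powerset, wtW D p S * g j S := by
  rw [tuplesK, ← Finset.sum_prod_piFinset]
  refine Finset.sum_congr rfl fun x _ => ?_
  rw [wtKW, ← Finset.prod_mul_distrib]

/-- `Σ_S wt(S)·[P(type S)] = PrW {type ∈ P}`. [folklore] -/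
theorem sum_wtW_ind (P : Ty → Bool) :
    ∑ S ∈ D.powerset, wtW D p S * (ib (P (ftype τ S)) : ℝ) = PrW D p (evT τ P) := by
  rw [PrW]
  refine Finset.sum_congr rfl fun S _ => ?_
  unfold ib evT Set.indicator
  by_cases h : P (ftype τ S) = true
  · simp [h]
  · simp [h]

omit [Fintype V] in
/-- `Σ_S wt(S) = 1`. [folklore] -/
theorem sum_wtW_one : ∑ S ∈ D.powerset, wtW D p S * (1 : ℝ) = 1 := by
  simp only [mul_one]; exact sum_wtW D p

/-- Expectation of a product of per-copy type indicators (copy `0` free): `PrW · PrW · PrW`. [this work] -/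
theorem sum_wtKW_ind3 (P1 P2 P3 : Ty → Bool) :
    ∑ x ∈ tuplesK D 4, wtKW D p x *
        ((ib (P1 (ftype τ (x 1))) : ℝ) * ib (P2 (ftype τ (x 2))) * ib (P3 (ftype τ (x 3)))) =
      PrW D p (evT τ P1) * PrW D p (evT τ P2) * PrW D p (evT τ P3) := by
  let g : Fin 4 → Finset (Sym2 V) → ℝ := fun j S =>
    if j = 1 then ib (P1 (ftype τ S)) else if j = 2 then ib (P2 (ftype τ S)) else if j = 3 then ib (P3 (ftype τ S)) else 1
  have hprod : ∀ x : Fin 4 → Finset (Sym2 V), ∏ j, g j (x j) =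
      (ib (P1 (ftype τ (x 1))) : ℝ) * ib (P2 (ftype τ (x 2))) * ib (P3 (ftype τ (x 3))) := fun x => by
    rw [Fin.prod_univ_four]; simp [g]
  have key := sum_wtKW_prod D p g
  simp only [hprod] at key
  rw [key, Fin.prod_univ_four]
  simp only [g]
  simp only [Fin.isValue, Fin.reduceEq, if_false, if_true]
  rw [sum_wtW_one, sum_wtW_ind, sum_wtW_ind, sum_wtW_ind, one_mul]

/-- **Expectation of the target cell function is `E₃`.** [this work] -/
theorem sum_wtKW_Tc (E : E3Target) :
    ∑ x ∈ tuplesK D 4, wtKW D p x * (Tc E (ftype τ (x 1)) (ftype τ (x 2)) (ftype τ (x 3)) : ℝ) =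
      2 * PrW D p (evT τ fun t => E.EA t && E.EB t && E.EC t) +
        PrW D p (evT τ E.EA) * PrW D p (evT τ E.EB) * PrW D p (evT τ E.EC) -
        PrW D p (evT τ E.EA) * PrW D p (evT τ fun t => E.EB t && E.EC t) -
        PrW D p (evT τ E.EB) * PrW D p (evT τ fun t => E.EA t && E.EC t) -
        PrW D p (evT τ E.EC) * PrW D p (evT τ fun t => E.EA t && E.EB t) := by
  have T := fun P => sum_wtKW_ind3 τ D p P (fun _ => true) (fun _ => true)
  have U := fun P Q => sum_wtKW_ind3 τ D p P Q (fun _ => true)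
  have W := sum_wtKW_ind3 τ D p E.EA E.EB E.EC
  have htrue : PrW D p (evT τ fun _ => true) = 1 := by
    have : evT τ (fun _ => true) = (Set.univ : Set (Finset (Sym2 V))) := by ext; simp [evT]
    rw [this, PrW_univ]
  simp only [htrue, mul_one, ib_true, Int.cast_one] at T U
  simp only [Tc, Int.cast_add, Int.cast_sub, Int.cast_mul, Int.cast_ofNat, mul_add, mul_sub, Finset.sum_add_distrib,
    Finset.sum_sub_distrib]
  have e2 : ∑ x ∈ tuplesK D 4, wtKW D p x * (2 * (ib (E.EA (ftype τ (x 1)) && E.EB (ftype τ (x 1)) && E.EC (ftype τ (x 1))) : ℝ)) =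
      2 * PrW D p (evT τ fun t => E.EA t && E.EB t && E.EC t) := by
    rw [← T (fun t => E.EA t && E.EB t && E.EC t), Finset.mul_sum]
    refine Finset.sum_congr rfl fun x _ => by ring
  rw [e2, W]
  have eA : ∑ x ∈ tuplesK D 4, wtKW D p x * ((ib (E.EA (ftype τ (x 1))) : ℝ) * ib (E.EB (ftype τ (x 2)) && E.EC (ftype τ (x 2)))) =
      PrW D p (evT τ E.EA) * PrW D p (evT τ fun t => E.EB t && E.EC t) := by
    rw [← U]
  have eB : ∑ x ∈ tuplesK D 4, wtKW D p x * ((ib (E.EB (ftype τ (x 1))) : ℝ) * ib (E.EA (ftype τ (x 2)) && E.EC (ftype τ (x 2)))) =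
      PrW D p (evT τ E.EB) * PrW D p (evT τ fun t => E.EA t && E.EC t) := by
    rw [← U]
  have eC : ∑ x ∈ tuplesK D 4, wtKW D p x * ((ib (E.EC (ftype τ (x 1))) : ℝ) * ib (E.EA (ftype τ (x 2)) && E.EB (ftype τ (x 2)))) =
      PrW D p (evT τ E.EC) * PrW D p (evT τ fun t => E.EA t && E.EB t) := by
    rw [← U]
  rw [eA, eB, eC]

/-- The weight of a cell: `Σ_x wt(x)·[code x = o] = Π_j PrW{type = o_j}`. [this work] -/
theorem sum_wtKW_cell (o : St4) :
    ∑ x ∈ tuplesK D 4, wtKW D p x * (ib (ceq (fun j => ftype τ (x j)) o) : ℝ) =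
      ∏ j, PrW D p (evT τ fun t => decide (t = o j)) := by
  have hi : ∀ x : Fin 4 → Finset (Sym2 V), (ib (ceq (fun j => ftype τ (x j)) o) : ℝ) =
      ∏ j, (ib (decide (ftype τ (x j) = o j)) : ℝ) := fun x => by
    rw [Fin.prod_univ_four]
    have e : ceq (fun j => ftype τ (x j)) o = (decide (ftype τ (x 0) = o 0) && (decide (ftype τ (x 1) = o 1) &&
        (decide (ftype τ (x 2) = o 2) && decide (ftype τ (x 3) = o 3)))) := by
      simp only [ceq, Bool.decide_and]
    rw [e, ib_and, ib_and, ib_and]; push_cast; ring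
  simp only [hi]
  rw [sum_wtKW_prod D p (fun j S => (ib (decide (ftype τ S = o j)) : ℝ))]
  exact Finset.prod_congr rfl fun j _ => sum_wtW_ind τ D p (fun t => decide (t = o j))

/-- Permuted cells have the same weight. [this work] -/
theorem cellWeight_perm (o : St4) {π : Fin 4 → Fin 4} (hπ : Function.Bijective π) :
    ∏ j, PrW D p (evT τ fun t => decide (t = (o ∘ π) j)) = ∏ j, PrW D p (evT τ fun t => decide (t = o j)) :=
  Fintype.prod_bijective π hπ _ _ fun _ => rfl

/-- Pulling a list sum through a finite sum. [folklore] -/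
theorem sum_listsum {ι κ : Type*} (s : Finset ι) (L : List κ) (h : κ → ι → ℝ) :
    ∑ x ∈ s, (L.map fun k => h k x).sum = (L.map fun k => ∑ x ∈ s, h k x).sum := by
  induction L with
  | nil => simp
  | cons k L ih => simp only [List.map_cons, List.sum_cons, Finset.sum_add_distrib, ih]

/-- The weight of a cell as a function. [this work] -/
noncomputable def cellW (o : St4) : ℝ := ∏ j, PrW D p (evT τ fun t => decide (t = o j))

/-- `E[f(code)] = Σ_o f(o)·W(o)`. [this work] -/
theorem sum_wtKW_cellfun (f : St4 → ℤ) :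
    ∑ x ∈ tuplesK D 4, wtKW D p x * (f (fun j => ftype τ (x j)) : ℝ) = ∑ o : St4, (f o : ℝ) * cellW τ D p o := by
  have hf : ∀ y : St4, (f y : ℝ) = ∑ o : St4, (f o : ℝ) * (ib (ceq y o) : ℝ) := fun y => by
    have e : ∀ o : St4, (f o : ℝ) * (ib (ceq y o) : ℝ) = if y = o then (f o : ℝ) else 0 := fun o => by
      by_cases h : y = o
      · rw [if_pos h, (ceq_eq_true_iff y o).2 h, ib_true, Int.cast_one, mul_one]
      · have : ceq y o = false := by
          cases hc : ceq y o
          · rfl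
          · exact absurd ((ceq_eq_true_iff y o).1 hc) h
        rw [if_neg h, this]; simp [ib]
    simp only [e, Finset.sum_ite_eq, Finset.mem_univ, if_true]
  have step : ∑ x ∈ tuplesK D 4, wtKW D p x * (f (fun j => ftype τ (x j)) : ℝ) =
      ∑ x ∈ tuplesK D 4, ∑ o : St4, (f o : ℝ) * (wtKW D p x * (ib (ceq (fun j => ftype τ (x j)) o) : ℝ)) := by
    refine Finset.sum_congr rfl fun x _ => ?_
    rw [hf (fun j => ftype τ (x j)), Finset.mul_sum]
    exact Finset.sum_congr rfl fun o _ => by ring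
  rw [step, Finset.sum_comm]
  refine Finset.sum_congr rfl fun o _ => ?_
  rw [← Finset.mul_sum, sum_wtKW_cell, cellW]

/-- Reindexing the cell sum by a permutation of the copies. [this work] -/
theorem sum_cell_comp (g : St4 → ℝ) {π : Fin 4 → Fin 4} (hπ : Function.Bijective π) :
    ∑ o : St4, g (o ∘ π) * cellW τ D p o = ∑ o : St4, g o * cellW τ D p o := by
  have hW : ∀ o : St4, cellW τ D p (o ∘ π) = cellW τ D p o := fun o => cellWeight_perm τ D p o hπ
  calc ∑ o : St4, g (o ∘ π) * cellW τ D p o = ∑ o : St4, g (o ∘ π) * cellW τ D p (o ∘ π) := by simp only [hW]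
    _ = ∑ o : St4, g o * cellW τ D p o := by
      let e : St4 ≃ St4 := (Equiv.ofBijective π hπ).symm.arrowCongr (Equiv.refl Ty)
      have he : ∀ o : St4, e o = o ∘ π := fun o => by
        funext i; simp [e, Equiv.arrowCongr_apply]
      rw [← Equiv.sum_comp e (fun o => g o * cellW τ D p o)]
      simp only [he]

/-- **A cell function with nonnegative symmetrisation has nonnegative expectation.** [this work] -/
theorem sum_wtKW_nonneg_of_symS (f : St4 → ℤ) (hf : ∀ o, 0 ≤ symS f o) {p : Sym2 V → ℝ} (hp0 : ∀ e, 0 ≤ p e)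
    (hp1 : ∀ e, p e ≤ 1) : 0 ≤ ∑ x ∈ tuplesK D 4, wtKW D p x * (f (fun j => ftype τ (x j)) : ℝ) := by
  rw [sum_wtKW_cellfun]
  have hW : ∀ o : St4, 0 ≤ cellW τ D p o := fun o => Finset.prod_nonneg fun j _ => PrW_nonneg _ hp0 hp1 _
  -- `Σ_o (symS f o)·W o = 24·Σ_o f(o)·W(o)` and the left side is nonnegative
  have h24 : ∑ o : St4, (symS f o : ℝ) * cellW τ D p o = 24 * ∑ o : St4, (f o : ℝ) * cellW τ D p o := by
    have e1 : ∀ o : St4, (symS f o : ℝ) * cellW τ D p o =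
        (permL.map fun π => (f (o ∘ π) : ℝ) * cellW τ D p o).sum := fun o => by
      rw [symS, Int.cast_list_sum, List.map_map, List.sum_map_mul_right]; rfl
    simp only [e1]
    rw [sum_listsum]
    have e2 : (permL.map fun π => ∑ o : St4, (f (o ∘ π) : ℝ) * cellW τ D p o) =
        permL.map fun _ => ∑ o : St4, (f o : ℝ) * cellW τ D p o :=
      List.map_congr_left fun π hπ => sum_cell_comp τ D p (fun o => (f o : ℝ)) (permL_bijective π hπ)
    rw [e2, List.map_const', List.sum_replicate, length_permL, nsmul_eq_mul, Nat.cast_ofNat]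
  have : 0 ≤ ∑ o : St4, (symS f o : ℝ) * cellW τ D p o :=
    Finset.sum_nonneg fun o _ => mul_nonneg (by exact_mod_cast hf o) (hW o)
  linarith

/-- Pulling a list sum through the weighted sum. [folklore] -/
theorem sum_mul_listsum {ι κ : Type*} (s : Finset ι) (w : ι → ℝ) (L : List κ) (g : κ → ι → ℝ) :
    ∑ x ∈ s, w x * (L.map fun k => g k x).sum = (L.map fun k => ∑ x ∈ s, w x * g k x).sum := by
  induction L with
  | nil => simp
  | cons k L ih => simp only [List.map_cons, List.sum_cons, mul_add, Finset.sum_add_distrib, ih]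

/-- **Certificate principle for hub certificates**: `E[S] = E[Pc(code)]` (measure preservation of every program). [this work] -/
theorem sum_wtKW_Sreal (c : Cert) (hc : c.wfT = true) :
    ∑ x ∈ tuplesK D 4, wtKW D p x * (Sreal τ c x : ℝ) =
      ∑ x ∈ tuplesK D 4, wtKW D p x * (Pc c (fun j => ftype τ (x j)) : ℝ) := by
  have wf1 : ∀ q ∈ c.one, q.wf = true := by
    simp only [Cert.wfT, Bool.and_eq_true, List.all_eq_true] at hc; exact hc.1
  have wf2 : ∀ q ∈ c.two, q.wfT = true := by
    simp only [Cert.wfT, Bool.and_eq_true, List.all_eq_true] at hc; exact hc.2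
  have hS : ∀ x : Fin 4 → Finset (Sym2 V), (Sreal τ c x : ℝ) =
      (c.one.map fun q => (q.val τ c x : ℝ)).sum + (c.two.map fun q => (q.val τ c x : ℝ)).sum := fun x => by
    simp only [Sreal, Int.cast_add, Int.cast_list_sum, List.map_map]; rfl
  have hP : ∀ x : Fin 4 → Finset (Sym2 V), (Pc c (fun j => ftype τ (x j)) : ℝ) =
      (c.one.map fun q => (q.ev c (fun j => ftype τ (x j)) : ℝ)).sum +
        (c.two.map fun q => (q.ev c (fun j => ftype τ (x j)) : ℝ)).sum := fun x => by
    simp only [Pc, Int.cast_add, Int.cast_list_sum, List.map_map]; rfl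
  simp only [hS, hP, mul_add, Finset.sum_add_distrib]
  rw [sum_mul_listsum (tuplesK D 4) (wtKW D p) c.one (fun q x => (q.val τ c x : ℝ)),
    sum_mul_listsum (tuplesK D 4) (wtKW D p) c.two (fun q x => (q.val τ c x : ℝ)),
    sum_mul_listsum (tuplesK D 4) (wtKW D p) c.one (fun q x => (q.ev c (fun j => ftype τ (x j)) : ℝ)),
    sum_mul_listsum (tuplesK D 4) (wtKW D p) c.two (fun q x => (q.ev c (fun j => ftype τ (x j)) : ℝ))]
  congr 1
  · refine congrArg List.sum (List.map_congr_left fun q hq => ?_)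
    exact Prog.sum_wtKW_out τ (P1.prog_wf (wf1 q hq)) p D (fun y => (q.ev c (fun j => ftype τ (y j)) : ℝ))
  · refine congrArg List.sum (List.map_congr_left fun q hq => ?_)
    exact Prog.sum_wtKW_out τ (P2.prog_wf (wf2 q hq)) p D (fun y => (q.ev c (fun j => ftype τ (y j)) : ℝ))

/-- **THE CONCLUSION.**  A usable hub certificate whose kernel check passes for all source types (with full coverage),
with the canonical bound `B = Pc + Dsc·Tc − z` of a transfer list, proves `E₃(A,B,C) ≥ 0` for the target events on
every finite graph, every placement of the four terminals and all coordinate probabilities in `[0,1]`. [this work] -/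
theorem e3_nonneg_of_hubCert (c : Cert) (E : E3Target) (Dsc : ℕ) (hD : 0 < Dsc) (Z : ZS) (hZ : zsymOK Z = true)
    (CH : Ty → List (Ty × ℕ × ℕ)) (hc : c.ok = true)
    (hchk : ∀ πX, piCheck c (fun t1 t2 t3 => Bfun c E Dsc Z πX t1 t2 t3) πX (CH πX) = true)
    (hcov : ∀ πX, covers πX (CH πX) = true) {p : Sym2 V → ℝ} (hp0 : ∀ e, 0 ≤ p e) (hp1 : ∀ e, p e ≤ 1) :
    0 ≤ 2 * PrW D p (evT τ fun t => E.EA t && E.EB t && E.EC t) +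
        PrW D p (evT τ E.EA) * PrW D p (evT τ E.EB) * PrW D p (evT τ E.EC) -
        PrW D p (evT τ E.EA) * PrW D p (evT τ fun t => E.EB t && E.EC t) -
        PrW D p (evT τ E.EB) * PrW D p (evT τ fun t => E.EA t && E.EC t) -
        PrW D p (evT τ E.EC) * PrW D p (evT τ fun t => E.EA t && E.EB t) := by
  have hwf : c.wf = true := by simp only [Cert.ok, Bool.and_eq_true] at hc; exact hc.1
  -- pointwise bound, summed with the nonnegative weights
  have hpt : ∀ x : Fin 4 → Finset (Sym2 V), (Sreal τ c x : ℝ) ≤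
      (Pc c (fun j => ftype τ (x j)) : ℝ) + Dsc * (Tc E (ftype τ (x 1)) (ftype τ (x 2)) (ftype τ (x 3)) : ℝ) -
        (zlkS Z (fun j => ftype τ (x j)) : ℝ) := fun x => by
    have h := Sreal_le_of_piCheck τ x hc (hchk (ftype τ (x 0))) (hcov (ftype τ (x 0)))
    have hmk : mk4 (ftype τ (x 0)) (ftype τ (x 1)) (ftype τ (x 2)) (ftype τ (x 3)) = fun j => ftype τ (x j) := by
      funext j; fin_cases j <;> rfl
    rw [Bfun, hmk] at h
    exact_mod_cast h
  have hsum : ∑ x ∈ tuplesK D 4, wtKW D p x * (Sreal τ c x : ℝ) ≤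
      ∑ x ∈ tuplesK D 4, wtKW D p x * ((Pc c (fun j => ftype τ (x j)) : ℝ) +
        Dsc * (Tc E (ftype τ (x 1)) (ftype τ (x 2)) (ftype τ (x 3)) : ℝ) - (zlkS Z (fun j => ftype τ (x j)) : ℝ)) :=
    Finset.sum_le_sum fun x _ => mul_le_mul_of_nonneg_left (hpt x) (wtKW_nonneg D hp0 hp1 x)
  rw [sum_wtKW_Sreal τ D p c (Cert.wfT_of_wf hwf)] at hsum
  have hz := sum_wtKW_nonneg_of_symS τ D (zlkS Z) (symS_nonneg_of_zsymOK hZ) hp0 hp1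
  simp only [mul_add, mul_sub, Finset.sum_add_distrib, Finset.sum_sub_distrib] at hsum
  have hT : ∑ x ∈ tuplesK D 4, wtKW D p x * (Dsc * (Tc E (ftype τ (x 1)) (ftype τ (x 2)) (ftype τ (x 3)) : ℝ)) =
      Dsc * ∑ x ∈ tuplesK D 4, wtKW D p x * (Tc E (ftype τ (x 1)) (ftype τ (x 2)) (ftype τ (x 3)) : ℝ) := by
    rw [Finset.mul_sum]; exact Finset.sum_congr rfl fun x _ => by ring
  rw [hT, sum_wtKW_Tc] at hsum
  have hD' : (0 : ℝ) < Dsc := by exact_mod_cast hD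
  nlinarith

end Expect

end FourCopyHub

end Summit.CriticalPhenomena.PercolationContinuityZ3.Theorems

end
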